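import Mathlib

/-!
# The general gate of the six-cell (XA′): the algebraic core — a bilinear corner argument
(blind cell PercRepro2, night-2 g28; proofs/NIGHT2-DARC.md §69)

In the six-cell sub-case the cleared (XA′) functional is LINEAR in the five gate masses,
`F(w) = F₀ + γ·a₀w − α·a₁w − κ·B_w + ρ·r₁w` (`B_w = b_w + r₀w`), with `γ, α ≥ 0`.  Five set-level
Ahlswede–Daykin facts constrain the gate: `a₁w·r₁u ≤ a₁u·r₁w`, `B_w·r₁u ≤ B_u·r₁w`, `o_w·a₀u ≤ o_u·a₀w`,
the gate's own log-supermodularity `a₁w·B_w ≤ (o_w + a₀w)·r₁w`, and `a₁u·B_u ≤ (o_u + a₀u)·r₁u`.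
Using the last three once, `(o_u + a₀u)·r₁w·r₁u²·F(w)` is bounded below by a function BILINEAR in
`(a₁w·r₁u, B_w·r₁u)` on the box `[0, a₁u·r₁w] × [0, B_u·r₁w]`; a bilinear function is nonnegative on
a box once it is at the four corners, and the four corner values are convex combinations of the
closed-gate value `F₀` with the top-gate, `1[j ∈ W]`-gate and `1[m ∈ W]`-gate values and the
gate-free inequality (★).  `xa_general_gate_alg` is that argument, division-free.
-/

namespace Summit.Ventures.PercRepro2.Coin

section GeneralGateAlg

variable {R : Type*} [Field R] [LinearOrder R] [IsStrictOrderedRing R]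

omit [LinearOrder R] [IsStrictOrderedRing R] in
/-- The bilinear interpolation identity on a box (pure algebra): the corner values weighted by
the areas of the four sub-boxes. -/
lemma bilinear_box_identity (K0 K1 K2 K3 x y X Y : R) :
    X * Y * (K0 - K1 * x - K2 * y + K3 * (x * y))
    = (X - x) * (Y - y) * K0 + x * (Y - y) * (K0 - K1 * X) + (X - x) * y * (K0 - K2 * Y)
      + x * y * (K0 - K1 * X - K2 * Y + K3 * (X * Y)) := by
  ring

/-- A bilinear function on a box is nonnegative once its four corner values are. -/
lemma bilinear_box_nonneg (K0 K1 K2 K3 x y X Y : R) (hx : 0 ≤ x) (hy : 0 ≤ y)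
    (hxX : x ≤ X) (hyY : y ≤ Y) (c00 : 0 ≤ K0) (cX0 : 0 ≤ K0 - K1 * X) (c0Y : 0 ≤ K0 - K2 * Y)
    (cXY : 0 ≤ K0 - K1 * X - K2 * Y + K3 * (X * Y)) :
    0 ≤ X * Y * (K0 - K1 * x - K2 * y + K3 * (x * y)) := by
  rw [bilinear_box_identity]
  have hX : 0 ≤ X - x := sub_nonneg.2 hxX
  have hY : 0 ≤ Y - y := sub_nonneg.2 hyY
  have t1 := mul_nonneg (mul_nonneg hX hY) c00
  have t2 := mul_nonneg (mul_nonneg hx hY) cX0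
  have t3 := mul_nonneg (mul_nonneg hX hy) c0Y
  have t4 := mul_nonneg (mul_nonneg hx hy) cXY
  linarith

/-- `0 ≤ M * F` with `0 < M` gives `0 ≤ F`. -/
lemma nonneg_of_mul_nonneg_of_pos (M F : R) (hM : 0 < M) (h : 0 ≤ M * F) : 0 ≤ F := by
  by_contra hneg
  have hneg' : F < 0 := not_le.1 hneg
  have := mul_neg_of_pos_of_neg hM hneg'
  linarith

/-- The main case of `xa_general_gate_alg`: all of `r₁w`, `a₁u`, `Bu`, `ou + a₀u` positive. -/
lemma xa_general_gate_alg_main (F₀ α κ ρ γ ou a₀u a₁u Bu r₁u ow a₀w a₁w Bw r₁w : R)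
    (hγ : 0 ≤ γ)
    (_hou : 0 ≤ ou) (ha₀u : 0 ≤ a₀u) (ha₁u : 0 < a₁u) (hBu : 0 < Bu) (hr₁u : 0 ≤ r₁u)
    (ha₁w : 0 ≤ a₁w) (hBw : 0 ≤ Bw) (hr₁w : 0 < r₁w) (hw3 : r₁w ≤ r₁u) (hP : 0 < ou + a₀u)
    (H2 : a₁w * r₁u ≤ a₁u * r₁w) (H3 : Bw * r₁u ≤ Bu * r₁w) (H4 : ow * a₀u ≤ ou * a₀w)
    (H5 : a₁w * Bw ≤ (ow + a₀w) * r₁w)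
    (hF0 : 0 ≤ F₀) (hFT : 0 ≤ F₀ + ρ * r₁u) (hFJ : 0 ≤ F₀ + ρ * r₁u - α * a₁u)
    (hFM : 0 ≤ F₀ + ρ * r₁u - κ * Bu)
    (hstar : γ * a₀u * ((ou + a₀u) * r₁u - a₁u * Bu) ≤
      (ou + a₀u) * r₁u * (F₀ + ρ * r₁u + γ * a₀u - α * a₁u - κ * Bu)) :
    0 ≤ F₀ + γ * a₀w - α * a₁w - κ * Bw + ρ * r₁w := by
  have hP0 : 0 ≤ ou + a₀u := hP.le
  have hr₁w0 : 0 ≤ r₁w := hr₁w.le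
  have hr₁u0 : 0 < r₁u := lt_of_lt_of_le hr₁w hw3
  -- the combined bilinear constraint `a₀u·a₁w·B_w ≤ a₀w·(ou + a₀u)·r₁w`
  have H5' : a₀u * (a₁w * Bw) ≤ a₀w * (ou + a₀u) * r₁w := by
    nlinarith [mul_le_mul_of_nonneg_left H5 ha₀u, mul_le_mul_of_nonneg_right H4 hr₁w0]
  -- the (★) corner in the form used below
  have hS : 0 ≤ (ou + a₀u) * r₁u * (F₀ + ρ * r₁u - α * a₁u - κ * Bu) + γ * a₀u * (a₁u * Bu) := by
    nlinarith [hstar]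
  have hru : 0 ≤ r₁u - r₁w := sub_nonneg.2 hw3
  -- the four corner values of the bilinear function
  have c00 : 0 ≤ (ou + a₀u) * r₁w * r₁u ^ 2 * (F₀ + ρ * r₁w) := by
    have e : (ou + a₀u) * r₁w * r₁u ^ 2 * (F₀ + ρ * r₁w)
        = (ou + a₀u) * r₁w * r₁u * ((r₁u - r₁w) * F₀ + r₁w * (F₀ + ρ * r₁u)) := by ring
    rw [e]
    exact mul_nonneg (mul_nonneg (mul_nonneg hP0 hr₁w0) hr₁u)
      (add_nonneg (mul_nonneg hru hF0) (mul_nonneg hr₁w0 hFT))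
  have cX0 : 0 ≤ (ou + a₀u) * r₁w * r₁u ^ 2 * (F₀ + ρ * r₁w)
      - (ou + a₀u) * r₁w * r₁u * α * (a₁u * r₁w) := by
    have e : (ou + a₀u) * r₁w * r₁u ^ 2 * (F₀ + ρ * r₁w) - (ou + a₀u) * r₁w * r₁u * α * (a₁u * r₁w)
        = (ou + a₀u) * r₁w * r₁u * ((r₁u - r₁w) * F₀ + r₁w * (F₀ + ρ * r₁u - α * a₁u)) := by ring
    rw [e]
    exact mul_nonneg (mul_nonneg (mul_nonneg hP0 hr₁w0) hr₁u)
      (add_nonneg (mul_nonneg hru hF0) (mul_nonneg hr₁w0 hFJ))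
  have c0Y : 0 ≤ (ou + a₀u) * r₁w * r₁u ^ 2 * (F₀ + ρ * r₁w)
      - (ou + a₀u) * r₁w * r₁u * κ * (Bu * r₁w) := by
    have e : (ou + a₀u) * r₁w * r₁u ^ 2 * (F₀ + ρ * r₁w) - (ou + a₀u) * r₁w * r₁u * κ * (Bu * r₁w)
        = (ou + a₀u) * r₁w * r₁u * ((r₁u - r₁w) * F₀ + r₁w * (F₀ + ρ * r₁u - κ * Bu)) := by ring
    rw [e]
    exact mul_nonneg (mul_nonneg (mul_nonneg hP0 hr₁w0) hr₁u)
      (add_nonneg (mul_nonneg hru hF0) (mul_nonneg hr₁w0 hFM))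
  have cXY : 0 ≤ (ou + a₀u) * r₁w * r₁u ^ 2 * (F₀ + ρ * r₁w)
      - (ou + a₀u) * r₁w * r₁u * α * (a₁u * r₁w) - (ou + a₀u) * r₁w * r₁u * κ * (Bu * r₁w)
      + γ * a₀u * ((a₁u * r₁w) * (Bu * r₁w)) := by
    have e : (ou + a₀u) * r₁w * r₁u ^ 2 * (F₀ + ρ * r₁w)
        - (ou + a₀u) * r₁w * r₁u * α * (a₁u * r₁w) - (ou + a₀u) * r₁w * r₁u * κ * (Bu * r₁w)
        + γ * a₀u * ((a₁u * r₁w) * (Bu * r₁w))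
        = r₁w * ((ou + a₀u) * r₁u * (r₁u - r₁w) * F₀
          + r₁w * ((ou + a₀u) * r₁u * (F₀ + ρ * r₁u - α * a₁u - κ * Bu) + γ * a₀u * (a₁u * Bu))) := by
      ring
    rw [e]
    exact mul_nonneg hr₁w0
      (add_nonneg (mul_nonneg (mul_nonneg (mul_nonneg hP0 hr₁u) hru) hF0) (mul_nonneg hr₁w0 hS))
  have hbil := bilinear_box_nonneg ((ou + a₀u) * r₁w * r₁u ^ 2 * (F₀ + ρ * r₁w))
    ((ou + a₀u) * r₁w * r₁u * α) ((ou + a₀u) * r₁w * r₁u * κ) (γ * a₀u)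
    (a₁w * r₁u) (Bw * r₁u) (a₁u * r₁w) (Bu * r₁w) (mul_nonneg ha₁w hr₁u) (mul_nonneg hBw hr₁u)
    H2 H3 c00 cX0 c0Y cXY
  -- the bilinear function bounds the multiplied functional from below
  have hlow : (ou + a₀u) * r₁w * r₁u ^ 2 * (F₀ + ρ * r₁w)
      - (ou + a₀u) * r₁w * r₁u * α * (a₁w * r₁u) - (ou + a₀u) * r₁w * r₁u * κ * (Bw * r₁u)
      + γ * a₀u * ((a₁w * r₁u) * (Bw * r₁u))
      ≤ (ou + a₀u) * r₁w * r₁u ^ 2 * (F₀ + γ * a₀w - α * a₁w - κ * Bw + ρ * r₁w) := by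
    have e : (ou + a₀u) * r₁w * r₁u ^ 2 * (F₀ + γ * a₀w - α * a₁w - κ * Bw + ρ * r₁w)
        - ((ou + a₀u) * r₁w * r₁u ^ 2 * (F₀ + ρ * r₁w)
          - (ou + a₀u) * r₁w * r₁u * α * (a₁w * r₁u) - (ou + a₀u) * r₁w * r₁u * κ * (Bw * r₁u)
          + γ * a₀u * ((a₁w * r₁u) * (Bw * r₁u)))
        = γ * r₁u ^ 2 * (a₀w * (ou + a₀u) * r₁w - a₀u * (a₁w * Bw)) := by ring
    have h := mul_nonneg (mul_nonneg hγ (sq_nonneg r₁u)) (sub_nonneg.2 H5')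
    linarith
  have hXY0 : 0 ≤ (a₁u * r₁w) * (Bu * r₁w) :=
    mul_nonneg (mul_nonneg ha₁u.le hr₁w0) (mul_nonneg hBu.le hr₁w0)
  have hM : 0 ≤ (a₁u * r₁w) * (Bu * r₁w) * ((ou + a₀u) * r₁w * r₁u ^ 2
      * (F₀ + γ * a₀w - α * a₁w - κ * Bw + ρ * r₁w)) :=
    le_trans hbil (mul_le_mul_of_nonneg_left hlow hXY0)
  have hmul : 0 < (a₁u * r₁w) * (Bu * r₁w) * ((ou + a₀u) * r₁w * r₁u ^ 2) := by positivity
  apply nonneg_of_mul_nonneg_of_pos _ _ hmul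
  have e : (a₁u * r₁w) * (Bu * r₁w) * ((ou + a₀u) * r₁w * r₁u ^ 2)
        * (F₀ + γ * a₀w - α * a₁w - κ * Bw + ρ * r₁w)
      = (a₁u * r₁w) * (Bu * r₁w) * ((ou + a₀u) * r₁w * r₁u ^ 2
        * (F₀ + γ * a₀w - α * a₁w - κ * Bw + ρ * r₁w)) := by ring
  rw [e]; exact hM

/-- **THE GENERAL GATE OF THE SIX-CELL (XA′), ALGEBRAIC CORE.**  `F₀` the closed-gate value,
`γ, α ≥ 0` the coefficients of `a₀w`, `−a₁w`; `κ`, `ρ` those of `−B_w`, `r₁w`; the five gate facts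
`H2`–`H6`; the closed, top, `1[j ∈ W]` and `1[m ∈ W]` gate values nonnegative; and (★).  Then the
functional of every gate vector is nonnegative. -/
theorem xa_general_gate_alg (F₀ α κ ρ γ ou a₀u a₁u Bu r₁u ow a₀w a₁w Bw r₁w : R)
    (hα : 0 ≤ α) (hγ : 0 ≤ γ)
    (hou : 0 ≤ ou) (ha₀u : 0 ≤ a₀u) (ha₁u : 0 ≤ a₁u) (hBu : 0 ≤ Bu) (hr₁u : 0 ≤ r₁u)
    (ha₀w : 0 ≤ a₀w) (ha₁w : 0 ≤ a₁w) (hBw : 0 ≤ Bw) (hr₁w : 0 ≤ r₁w)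
    (hw1 : a₁w ≤ a₁u) (hw2 : Bw ≤ Bu) (hw3 : r₁w ≤ r₁u)
    (H2 : a₁w * r₁u ≤ a₁u * r₁w) (H3 : Bw * r₁u ≤ Bu * r₁w) (H4 : ow * a₀u ≤ ou * a₀w)
    (H5 : a₁w * Bw ≤ (ow + a₀w) * r₁w) (H6 : a₁u * Bu ≤ (ou + a₀u) * r₁u)
    (hF0 : 0 ≤ F₀) (hFT : 0 ≤ F₀ + ρ * r₁u) (hFJ : 0 ≤ F₀ + ρ * r₁u - α * a₁u)
    (hFM : 0 ≤ F₀ + ρ * r₁u - κ * Bu)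
    (hstar : γ * a₀u * ((ou + a₀u) * r₁u - a₁u * Bu) ≤
      (ou + a₀u) * r₁u * (F₀ + ρ * r₁u + γ * a₀u - α * a₁u - κ * Bu)) :
    0 ≤ F₀ + γ * a₀w - α * a₁w - κ * Bw + ρ * r₁w := by
  have hP0 : 0 ≤ ou + a₀u := add_nonneg hou ha₀u
  have hru : 0 ≤ r₁u - r₁w := sub_nonneg.2 hw3
  have hγa : 0 ≤ γ * a₀w := mul_nonneg hγ ha₀w
  rcases eq_or_lt_of_le hr₁w with hr₁w0 | hr₁w0
  · -- `r₁w = 0`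
    rw [← hr₁w0] at H2 H3 ⊢
    rcases eq_or_lt_of_le hr₁u with hr₁u0 | hr₁u0
    · -- `r₁u = 0`: `a₁u·Bu ≤ 0`
      rw [← hr₁u0] at H6 hFT hFJ hFM
      have hab : a₁u * Bu = 0 := le_antisymm (by linarith) (mul_nonneg ha₁u hBu)
      rcases mul_eq_zero.1 hab with h | h
      · have ha1w : a₁w = 0 := le_antisymm (h ▸ hw1) ha₁w
        rw [ha1w]
        by_cases hκ : 0 ≤ κ
        · have := mul_le_mul_of_nonneg_left hw2 hκ
          linarith
        · have hκ' : κ < 0 := not_le.1 hκ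
          have := mul_nonneg (neg_nonneg.2 hκ'.le) hBw
          linarith
      · have hBw0 : Bw = 0 := le_antisymm (h ▸ hw2) hBw
        rw [hBw0]
        have := mul_le_mul_of_nonneg_left hw1 hα
        linarith
    · -- `r₁u > 0`: `a₁w = B_w = 0`
      have ha1w : a₁w = 0 := by
        have h1 : a₁w * r₁u ≤ 0 := by linarith
        have h2 := le_antisymm h1 (mul_nonneg ha₁w hr₁u)
        rcases mul_eq_zero.1 h2 with h | h
        · exact h
        · exact absurd h hr₁u0.ne'
      have hBw0 : Bw = 0 := by
        have h1 : Bw * r₁u ≤ 0 := by linarith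
        have h2 := le_antisymm h1 (mul_nonneg hBw hr₁u)
        rcases mul_eq_zero.1 h2 with h | h
        · exact h
        · exact absurd h hr₁u0.ne'
      rw [ha1w, hBw0]
      linarith
  · -- `r₁w > 0`, hence `r₁u > 0`
    have hr₁u0 : 0 < r₁u := lt_of_lt_of_le hr₁w0 hw3
    have t0 : 0 ≤ (r₁u - r₁w) * F₀ := mul_nonneg hru hF0
    have tγ : 0 ≤ γ * r₁u * a₀w := mul_nonneg (mul_nonneg hγ hr₁u) ha₀w
    rcases eq_or_lt_of_le ha₁u with ha₁u0 | ha₁u0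
    · -- `a₁u = 0`: `a₁w = 0`; interpolate in `B_w` only
      have ha1w : a₁w = 0 := le_antisymm (ha₁u0 ▸ hw1) ha₁w
      rw [ha1w]
      apply nonneg_of_mul_nonneg_of_pos r₁u _ hr₁u0
      have tM : 0 ≤ r₁w * (F₀ + ρ * r₁u - κ * Bu) := mul_nonneg hr₁w hFM
      have tT : 0 ≤ r₁w * (F₀ + ρ * r₁u) := mul_nonneg hr₁w hFT
      by_cases hκ : 0 ≤ κ
      · have e : r₁u * (F₀ + γ * a₀w - α * 0 - κ * Bw + ρ * r₁w)
            = (r₁u - r₁w) * F₀ + r₁w * (F₀ + ρ * r₁u - κ * Bu) + γ * r₁u * a₀w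
              + κ * (Bu * r₁w - Bw * r₁u) := by ring
        rw [e]
        have := mul_nonneg hκ (sub_nonneg.2 H3)
        linarith
      · have hκ' : κ < 0 := not_le.1 hκ
        have e : r₁u * (F₀ + γ * a₀w - α * 0 - κ * Bw + ρ * r₁w)
            = (r₁u - r₁w) * F₀ + r₁w * (F₀ + ρ * r₁u) + γ * r₁u * a₀w + (-κ) * (Bw * r₁u) := by ring
        rw [e]
        have := mul_nonneg (neg_nonneg.2 hκ'.le) (mul_nonneg hBw hr₁u)
        linarith
    · rcases eq_or_lt_of_le hBu with hBu0 | hBu0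
      · -- `Bu = 0`: `B_w = 0`; interpolate in `a₁w` only
        have hBw0 : Bw = 0 := le_antisymm (hBu0 ▸ hw2) hBw
        rw [hBw0]
        apply nonneg_of_mul_nonneg_of_pos r₁u _ hr₁u0
        have tJ : 0 ≤ r₁w * (F₀ + ρ * r₁u - α * a₁u) := mul_nonneg hr₁w hFJ
        have e : r₁u * (F₀ + γ * a₀w - α * a₁w - κ * 0 + ρ * r₁w)
            = (r₁u - r₁w) * F₀ + r₁w * (F₀ + ρ * r₁u - α * a₁u) + γ * r₁u * a₀w
              + α * (a₁u * r₁w - a₁w * r₁u) := by ring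
        rw [e]
        have := mul_nonneg hα (sub_nonneg.2 H2)
        linarith
      · rcases eq_or_lt_of_le hP0 with hPz | hPz
        · -- `ou + a₀u = 0`: then `a₁u·Bu ≤ 0`, impossible
          exfalso
          have h1 : a₁u * Bu ≤ 0 := by rw [← hPz] at H6; linarith
          exact absurd h1 (not_le.2 (mul_pos ha₁u0 hBu0))
        · exact xa_general_gate_alg_main F₀ α κ ρ γ ou a₀u a₁u Bu r₁u ow a₀w a₁w Bw r₁w hγ hou ha₀u
            ha₁u0 hBu0 hr₁u ha₁w hBw hr₁w0 hw3 hPz H2 H3 H4 H5 hF0 hFT hFJ hFM hstar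

end GeneralGateAlg

end Summit.Ventures.PercRepro2.Coin
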